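import Summits.HubbardSuperconductivity.HubbardSuperconductivity.Theorems.AnisotropyChordTransferFibre3FinXDEvalW

/-!
# Route `AnisotropyChord` / H0 rotor rung: FIN per-`L` SIDE-CONDITION cell facts, `L = 13` (GM₃ cells 156–161)

Kernel facts `sdCellAnyZ 13 (49/50) 20 la lb (c, bn, aD) = true` (regime clause `mHole ≥ 0 ∧ facMI·η·(aD + b/(2+cos θ)) < c` on the cell, or vacuity), g5's `xbEval` objects, `decide +kernel`.
Prover seat `hubbard-h0-rotor-p3` g7; helper for piece A = stmt-HubbardSuperconductivity-23918 of rung 19089 (`--supports`, helper class).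
WHAT THIS IS NOT: nothing here proves superconductivity in the Hubbard model (rotor TARGET as worded stays FALSE, g15 verdict); kernel facts /
assembly for ONE conditional reduction at one `L`.  No sorry.
-/

set_option linter.dupNamespace false
set_option autoImplicit false

namespace Summit.HubbardSuperconductivity.HubbardSuperconductivity.Theorems.AnisotropyChord.Transfer.Fibre3

namespace FinXD

/-- side-condition cell `[13953948594403953, 14121395977536801]` of `L = 13` (`cert`). [folklore] -/
theorem sd13_156 : sdCellAnyZ 13 (49/50 : ℚ) 20 13953948594403953 14121395977536801 ((9/20 : ℚ), (28 : ℕ), (1/20 : ℚ)) = true := by (rw [← sdCellAnyZW_eq]; decide +kernel)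

/-- side-condition cell `[14121395977536801, 14290852729267243]` of `L = 13` (`cert`). [folklore] -/
theorem sd13_157 : sdCellAnyZ 13 (49/50 : ℚ) 20 14121395977536801 14290852729267243 ((9/20 : ℚ), (29 : ℕ), (1/20 : ℚ)) = true := by (rw [← sdCellAnyZW_eq]; decide +kernel)

/-- side-condition cell `[14290852729267243, 14462342962018453]` of `L = 13` (`cert`). [folklore] -/
theorem sd13_158 : sdCellAnyZ 13 (49/50 : ℚ) 20 14290852729267243 14462342962018453 ((9/20 : ℚ), (29 : ℕ), (1/20 : ℚ)) = true := by (rw [← sdCellAnyZW_eq]; decide +kernel)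

/-- side-condition cell `[14462342962018453, 14635891077562675]` of `L = 13` (`cert`). [folklore] -/
theorem sd13_159 : sdCellAnyZ 13 (49/50 : ℚ) 20 14462342962018453 14635891077562675 ((9/20 : ℚ), (29 : ℕ), (1/20 : ℚ)) = true := by (rw [← sdCellAnyZW_eq]; decide +kernel)

/-- side-condition cell `[14635891077562675, 21953836616344017]` of `L = 13` (`num`). [folklore] -/
theorem sd13_160 : sdCellAnyZ 13 (49/50 : ℚ) 20 14635891077562675 21953836616344017 ((1 : ℚ), (1 : ℕ), (1 : ℚ)) = true := by (rw [← sdCellAnyZW_eq]; decide +kernel)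

/-- side-condition cell `[21953836616344017, 26447477706912876]` of `L = 13` (`num`). [folklore] -/
theorem sd13_161 : sdCellAnyZ 13 (49/50 : ℚ) 20 21953836616344017 26447477706912876 ((1 : ℚ), (1 : ℕ), (1 : ℚ)) = true := by (rw [← sdCellAnyZW_eq]; decide +kernel)

end FinXD

end Summit.HubbardSuperconductivity.HubbardSuperconductivity.Theorems.AnisotropyChord.Transfer.Fibre3
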